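import Mathlib.Analysis.Calculus.BumpFunction.FiniteDimension
import Mathlib.Analysis.Calculus.BumpFunction.InnerProduct
import Mathlib.Analysis.Distribution.AEEqOfIntegralContDiff
import Mathlib.Analysis.Matrix.Normed
import Mathlib.Analysis.SpecialFunctions.Exponential
import Mathlib.Analysis.SpecialFunctions.Log.Basic
import Mathlib.MeasureTheory.Function.LocallyIntegrable
import Mathlib.MeasureTheory.Integral.DominatedConvergence
import Mathlib.MeasureTheory.Measure.OpenPos
import Mathlib.NumberTheory.ArithmeticFunction.VonMangoldt
import Mathlib.Topology.Instances.Matrix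
import Mathlib.Topology.UniformSpace.Matrix
import HarnessLib

/-!
# Barrier: a finite-dimensional flow carrier has a continuous Lefschetz density, so its dynamical trace formula carries no closed-orbit (or prime) atoms (Deninger 2002, §3 after Thm 3.3; Álvarez López–Kordyukov 2008, Cor. 1.4)

Barrier catalogue `Literature/Barriers/RiemannHypothesis/` (D-0021), entry `FiniteCarrierNoOrbitAtoms`
(namespace `Literature.Barriers.RiemannHypothesis`; the catalogued declaration is
`FiniteCarrierNoOrbitAtoms`, PROVED unconditionally as `FiniteCarrierNoOrbitAtoms_holds`; everything
in this file is proved from Mathlib — the file introduces no named fact, net fact debt `0`).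

Deninger's programme asks for a "dynamical cohomology" `H^•` of `Spec ℤ` (more generally of an
arithmetic scheme) with an `ℝ`-flow `φ^t` whose alternating trace satisfies a dynamical Lefschetz
trace formula whose closed-orbit side is the prime side of the explicit formulae: closed orbits
`γ ↔` primes `p`, `l(γ) = log p`, iterates `↔` prime powers. The model is the trace formula for a
flow on a foliated manifold, [Deninger2002, Conj. 3.1, eq. (11)]:
`Σ_n (-1)^n Tr(φ^* | H̄^n_𝓕(X)) = Σ_γ l(γ) Σ_{k ≥ 1} ε_γ(k) δ_{k l(γ)} + Σ_x ε_x |1 - e^{κ_x t}|^{-1}`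
in `𝒟'(ℝ^{>0})`, proved by Álvarez López–Kordyukov for flows transversal to a codimension-one
foliation [Deninger2002, Thm 3.3, eq. (12)] with the trace DEFINED distributionally,
`Tr(φ^* | H̄^n)(φ) := tr ∫ φ(t) φ^{t*} dt`. Immediately after (12) Deninger prints the observation
this entry formalises (JDMV 103 / arXiv:math/0204110, §3, the paragraph after Thm 3.3; held text
`paper:arxiv-math_0204110`, chunk p0006 L68, read at page):

> "It follows from the theorem that if the right hand side of (12) is non-zero, at least one of the
> cohomology groups `H̄^n_𝓕(X)` must be infinite dimensional. Otherwise the alternating sum of traces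
> would be a smooth function and hence have empty singular support."

Álvarez López–Kordyukov print the same mechanism for Lie foliations (Trends in Math. 2008 =
arXiv:math/0703753, §1; held text `paper:arxiv-math_0703753`, chunks p0003 L94–95, p0004 L104–113,
read at page): the Lefschetz distribution `L_dis(𝓕)` "is supported in the union of a discrete set of
orbits", while "`L_dis(𝓕) ≡ L(𝓕) · Λ` when `H̄(𝓕)` is of finite dimension" (a smooth density),
whence **Corollary 1.4**: "If `H̄(𝓕)` is of finite dimension and `codim 𝓕 > 0`, then
`L_dis(𝓕) ≡ L(𝓕) = 0`" — "`χ(𝓕)` is useless: it vanishes just when it can be defined."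

## The technique (finite-dimensional flow carriers)

`FiniteLefschetzCarrier`: finitely many pieces `H^i = ℂ^{d_i}` with weights `c_i ∈ ℂ` (the signs
`(-1)^i`, or multiplicities) and CONTINUOUS one-parameter families `T_i : ℝ → M_{d_i}(ℂ)` (the flow
on `H^i`; `FiniteLefschetzCarrier.ofGenerators`: `T_i(t) = exp(t Θ_i)` for infinitesimal generators
`Θ_i`, continuity from Mathlib's `differentiable_exp_smul_const`). Its Lefschetz density is
`L_C(t) = Σ_i c_i tr T_i(t)` (`density`, continuous: `continuous_density`) and its Lefschetz
distribution is `g ↦ ∫ g(t) L_C(t) dt` on real test functions (`distribution`; Mathlib's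
test-function convention of `IsOpen.ae_eq_zero_of_integral_contDiff_smul_eq_zero`: `g : ℝ → ℝ`,
`ContDiff ℝ ∞ g`, `HasCompactSupport g`, `tsupport g ⊆ U`, integrand `g t • L t`).

## The obstruction (what this file vendors) — PROVED

* `FiniteCarrierNoOrbitAtoms.tendsto_integral_bump_smul`, `….atomWeight_eq_zero`: an `L¹_loc`
  density has no atoms — if `∫ g • F = m · g(a) + ∫ g • h` for all smooth `g` supported in a window
  around `a` (`F`, `h` integrable there), then `m = 0` (smooth bumps `g_n` at `a` with `g_n(a) = 1`
  and supports shrinking to `{a}`: the integrals tend to `0` by dominated convergence).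
* `FiniteCarrierNoOrbitAtoms.eq_zero_of_continuous_of_integral_eq_zero_off_null`: a continuous
  density whose distribution vanishes off a closed Lebesgue-null set is `≡ 0` (fundamental lemma of
  the calculus of variations, Mathlib, plus continuity).
* `FiniteLefschetzCarrier.atomWeight_eq_zero` = the catalogued `FiniteCarrierNoOrbitAtoms(_holds)`:
  the Lefschetz distribution of a finite carrier equals `m · δ_a + h` on a window only if `m = 0`;
  `not_exists_finiteLefschetzCarrier_of_atom` / `…_closedOrbit` (Deninger's wording: a non-zero
  atom `l(γ) ε_γ(k) δ_{k l(γ)}` forces some piece to be infinite-dimensional).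
* `FiniteLefschetzCarrier.not_vonMangoldt_side`: the arithmetic instance — on the window
  `(log √2, log 2√2)` the closed-orbit side `g ↦ Σ_n Λ(n) w(n) g(log n)` (any weights, `w(2) ≠ 0`;
  `FiniteCarrierNoOrbitAtoms.tsum_vonMangoldt_window`: it is `log 2 · w(2) · δ_{log 2}` there, as
  `log 3 > (3/2) log 2`) is not the Lefschetz distribution of any finite carrier, even modulo an
  integrable function.
* `FiniteLefschetzCarrier.density_eq_zero_of_support_null` / `…_countable`: Cor. 1.4 at finite
  level — Lefschetz distribution supported in a null (e.g. countable) closed set of periods ⇒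
  Lefschetz density `≡ 0`.

## References

* [Deninger2002] C. Deninger, *Number theory and dynamical systems on foliated spaces*, Jahresber.
  DMV 103 (2001) 79–100 = arXiv:math/0204110 — §3: Conj. 3.1 (eq. (11)), Thm 3.3 ([AK2], eq. (12))
  and the paragraph after it (quoted above); §5 Thm 5.9 and Example 1 (the `q^ℤ`-solenoid of an
  ordinary elliptic curve: `H^1` infinite-dimensional, `Tr := Σ_{λ ∈ Sp(Θ)} e^{tλ}` a distribution,
  trace formula a theorem); §5 last paragraph ("an infinite dimensional dissipative dynamical
  system"). Read at page (held text, chunks p0006, p0013).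
* [AlvarezLopezKordyukov2008] J. A. Álvarez López, Y. A. Kordyukov, *Lefschetz distribution of Lie
  foliations*, in: C*-algebras and Elliptic Theory II, Trends in Math., Birkhäuser 2008, 1–40 =
  arXiv:math/0703753 — §1: Prop. 1.1 (the Lefschetz distribution), "`L_dis(𝓕) ≡ L(𝓕)·Λ` when
  `H̄(𝓕)` is of finite dimension", Thm 1.3 (distributional Lefschetz trace formula), Cor. 1.4
  (quoted above), Cor. 1.5. Read at page (held text, chunks p0003–p0004).

## Design notes

* Test functions are real-valued smooth compactly supported `g : ℝ → ℝ` acting by `g t • F t`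
  (`ℝ`-scalar action on `ℂ`), exactly as in Mathlib's `ae_eq_zero_of_integral_contDiff_smul_eq_zero`
  family, so that the Cor. 1.4 form is one line from Mathlib.
* "Equals `m · δ_a` on a window, modulo `h ∈ L¹`": the closed-orbit side of (11)/(12) near a period
  `a = k·l(γ)` is `(Σ_{(γ',k') : k' l(γ') = a} l(γ') ε_{γ'}(k')) · δ_a` plus terms smooth on the
  window (the fixed-point terms are smooth on `t > 0`; other periods are finitely many in a bounded
  window); for `Spec ℤ` the atoms sit at `k log p` with weight `log p` (times a normalisation weight),
  isolated, so the window hypothesis with `h` integrable is the faithful local form. The weights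
  `c_i` are arbitrary complex numbers (signs, multiplicities, super-traces all covered); the operator
  families need only be continuous (one-parameter groups `e^{tΘ}` are the case `ofGenerators`).
* Deliberately NOT here: foliations, leafwise cohomology, trace-class operators and `𝒟'`-valued
  traces (the infinite-dimensional side, where the formula is a theorem — these are the EVASIONS);
  Guillemin's formula; any statement about `ζ`. The explicit formula itself is not imported: the
  arithmetic corollary is stated directly on the von Mangoldt atoms `Σ_n Λ(n) w(n) δ_{log n}` with
  free weights `w`, which covers every normalisation of the prime side.
-/

noncomputable section

open MeasureTheory Filter Set Metric Topology
open scoped ContDiff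

namespace Literature.Barriers.RiemannHypothesis

namespace FiniteCarrierNoOrbitAtoms

/-! ## The analytic core: a locally integrable density carries no Dirac atom -/

/-- Shrinking bumps kill a locally integrable density: if `F` is integrable on the window
`(a - ε, a + ε)` and `b n` are smooth bumps centred at `a` with outer radii `< ε` tending to `0`,
then `∫ bₙ • F → 0` (dominated convergence; the integrands tend to `0` off the null set `{a}`).
This is the quantitative form of the printed step "the alternating sum of traces would be a smooth
function and hence have empty singular support". [cite: Deninger2002, §3 after Thm 3.3] -/
theorem tendsto_integral_bump_smul {F : ℝ → ℂ} {a ε : ℝ}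
    (hF : IntegrableOn F (Ioo (a - ε) (a + ε)))
    (b : ℕ → ContDiffBump a) (hb : ∀ n, (b n).rOut < ε)
    (hb0 : Tendsto (fun n => (b n).rOut) atTop (𝓝 0)) :
    Tendsto (fun n => ∫ t, (b n) t • F t) atTop (𝓝 0) := by
  set I := Ioo (a - ε) (a + ε) with hI_def
  have hI : ∀ n, ∫ t, (b n) t • F t = ∫ t in I, (b n) t • F t := by
    intro n
    refine (setIntegral_eq_integral_of_forall_compl_eq_zero fun t ht => ?_).symm
    have hzero : (b n) t = 0 := by
      apply (b n).zero_of_le_dist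
      by_contra hlt
      push Not at hlt
      apply ht
      rw [Real.dist_eq] at hlt
      have h1 := (abs_lt.1 (hlt.trans (hb n)))
      exact ⟨by linarith [h1.1], by linarith [h1.2]⟩
    rw [hzero, zero_smul]
  simp_rw [hI]
  have key := tendsto_integral_of_dominated_convergence (μ := volume.restrict I)
    (F := fun n t => (b n) t • F t) (f := fun _ => (0 : ℂ)) (fun t => ‖F t‖)
    (fun n => ((b n).continuous.aestronglyMeasurable).smul hF.aestronglyMeasurable)
    hF.norm
    (fun n => ae_of_all _ fun t => by
      rw [norm_smul, Real.norm_eq_abs, abs_of_nonneg (b n).nonneg]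
      calc (b n) t * ‖F t‖ ≤ 1 * ‖F t‖ := by gcongr; exact (b n).le_one
        _ = ‖F t‖ := one_mul _)
    (by
      filter_upwards [Measure.ae_ne (volume.restrict I) a] with t ht
      have hd : 0 < dist t a := dist_pos.mpr ht
      have hev : ∀ᶠ n in atTop, (b n).rOut < dist t a := (tendsto_order.1 hb0).2 _ hd
      refine (tendsto_const_nhds (x := (0 : ℂ))).congr' ?_
      filter_upwards [hev] with n hn
      rw [(b n).zero_of_le_dist hn.le, zero_smul])
  simpa using key

/-- **A locally integrable density has no atoms** (the singular support of an `L¹_loc`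
function is empty). If `F` and `h` are integrable on the window `(a - ε, a + ε)` and the
distribution `g ↦ ∫ g • F` equals `m • δ_a + h` there — i.e.
`∫ g • F = m · g(a) + ∫ g • h` for every smooth `g` compactly supported in the window — then
`m = 0`: an `L¹_loc` density has empty singular support, so it cannot carry a Dirac term.
[cite: Deninger2002, §3 after Thm 3.3] [cite: AlvarezLopezKordyukov2008, Cor 1.4] -/
theorem atomWeight_eq_zero {F h : ℝ → ℂ} {a ε : ℝ} {m : ℂ} (hε : 0 < ε)
    (hF : IntegrableOn F (Ioo (a - ε) (a + ε))) (hh : IntegrableOn h (Ioo (a - ε) (a + ε)))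
    (H : ∀ g : ℝ → ℝ, ContDiff ℝ ∞ g → HasCompactSupport g →
      tsupport g ⊆ Ioo (a - ε) (a + ε) → ∫ t, g t • F t = m * g a + ∫ t, g t • h t) :
    m = 0 := by
  -- a sequence of smooth bumps centred at `a` with outer radius `ε / (2 (n + 1))`
  have hr : ∀ n : ℕ, 0 < ε / (2 * ((n : ℝ) + 1)) := fun n => by positivity
  let b : ℕ → ContDiffBump a := fun n =>
    ⟨ε / (2 * ((n : ℝ) + 1)) / 2, ε / (2 * ((n : ℝ) + 1)), half_pos (hr n), half_lt_self (hr n)⟩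
  have hb : ∀ n, (b n).rOut < ε := fun n => by
    change ε / (2 * ((n : ℝ) + 1)) < ε
    rw [div_lt_iff₀ (by positivity)]
    nlinarith [(Nat.cast_nonneg n : (0 : ℝ) ≤ n)]
  have hb0 : Tendsto (fun n => (b n).rOut) atTop (𝓝 0) := by
    change Tendsto (fun n : ℕ => ε / (2 * ((n : ℝ) + 1))) atTop (𝓝 0)
    have h2 : Tendsto (fun n : ℕ => ε / 2 * (1 / ((n : ℝ) + 1))) atTop (𝓝 (ε / 2 * 0)) :=
      tendsto_one_div_add_atTop_nhds_zero_nat.const_mul _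
    rw [mul_zero] at h2
    refine h2.congr fun n => ?_
    field_simp
  -- the hypothesis on the bumps reads `m = ∫ bₙ • F - ∫ bₙ • h`
  have key : ∀ n, m = (∫ t, (b n) t • F t) - ∫ t, (b n) t • h t := by
    intro n
    have hsub : tsupport (b n : ℝ → ℝ) ⊆ Ioo (a - ε) (a + ε) := by
      rw [(b n).tsupport_eq]
      intro t ht
      rw [mem_closedBall, Real.dist_eq] at ht
      have h1 := abs_le.1 ht
      have h2 := hb n
      exact ⟨by linarith [h1.1], by linarith [h1.2]⟩
    have := H (b n) (b n).contDiff (b n).hasCompactSupport hsub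
    rw [this, (b n).one_of_mem_closedBall (mem_closedBall_self (b n).rIn_pos.le)]
    push_cast
    ring
  have lim : Tendsto (fun n => (∫ t, (b n) t • F t) - ∫ t, (b n) t • h t) atTop (𝓝 (0 - 0)) :=
    (tendsto_integral_bump_smul hF b hb hb0).sub (tendsto_integral_bump_smul hh b hb hb0)
  rw [sub_zero] at lim
  exact tendsto_nhds_unique tendsto_const_nhds (lim.congr fun n => (key n).symm)

/-- The same with a CONTINUOUS density `F` (the case of a finite-dimensional flow carrier):
`∫ g • F = m · g(a) + ∫ g • h` on a window around `a`, `h` integrable there, forces `m = 0`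
("would be a smooth function and hence have empty singular support").
[cite: Deninger2002, §3 after Thm 3.3] -/
theorem atomWeight_eq_zero_of_continuous {F h : ℝ → ℂ} {a ε : ℝ} {m : ℂ} (hε : 0 < ε)
    (hF : Continuous F) (hh : IntegrableOn h (Ioo (a - ε) (a + ε)))
    (H : ∀ g : ℝ → ℝ, ContDiff ℝ ∞ g → HasCompactSupport g →
      tsupport g ⊆ Ioo (a - ε) (a + ε) → ∫ t, g t • F t = m * g a + ∫ t, g t • h t) :
    m = 0 :=
  atomWeight_eq_zero hε ((hF.integrableOn_Icc).mono_set Ioo_subset_Icc_self) hh H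

/-- **A continuous density supported (as a distribution) in a null closed set vanishes**: if `F`
is continuous and `∫ g • F = 0` for every smooth `g` compactly supported in the complement of a
closed Lebesgue-null set `D` (e.g. a discrete set of orbit lengths), then `F = 0` — the step
"`L_dis(𝓕)` is supported in the union of a discrete set of orbits … [and is `L(𝓕)·Λ`, smooth, when
`H̄(𝓕)` is of finite dimension], therefore … `L_dis(𝓕) ≡ L(𝓕) = 0`".
[cite: AlvarezLopezKordyukov2008, Cor 1.4] -/
theorem eq_zero_of_continuous_of_integral_eq_zero_off_null {F : ℝ → ℂ} (hF : Continuous F)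
    {D : Set ℝ} (hD : IsClosed D) (hD0 : volume D = 0)
    (H : ∀ g : ℝ → ℝ, ContDiff ℝ ∞ g → HasCompactSupport g → tsupport g ⊆ Dᶜ →
      ∫ t, g t • F t = 0) :
    F = 0 := by
  have h1 : ∀ᵐ t ∂volume, t ∈ Dᶜ → F t = 0 :=
    hD.isOpen_compl.ae_eq_zero_of_integral_contDiff_smul_eq_zero
      ((hF.locallyIntegrable (μ := volume)).locallyIntegrableOn _) H
  have h2 : ∀ᵐ t ∂volume, t ∈ Dᶜ := compl_mem_ae_iff.mpr hD0
  have h3 : F =ᵐ[volume] (fun _ => (0 : ℂ)) := by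
    filter_upwards [h1, h2] with t ht ht'
    exact ht ht'
  exact (hF.ae_eq_iff_eq volume continuous_const).1 h3

/-! ## The prime-power atoms are isolated: the window around `log 2` -/

/-- On the window `(log 2 - ½ log 2, log 2 + ½ log 2) = (log √2, log 2√2)` the only logarithm of a
prime power is `log 2`: for every `g` supported in that window and all weights `w`,
`Σ_n Λ(n) w(n) g(log n) = log 2 · w(2) · g(log 2)` (for `n ≥ 3`, `log n ≥ log 3 > (3/2) log 2`
since `9 > 8`; `Λ(0) = Λ(1) = 0`). [folklore] -/
private theorem tsum_vonMangoldt_window (w : ℕ → ℂ) {g : ℝ → ℝ}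
    (hg : tsupport g ⊆ Ioo (Real.log 2 - Real.log 2 / 2) (Real.log 2 + Real.log 2 / 2)) :
    ∑' n : ℕ, (ArithmeticFunction.vonMangoldt n : ℂ) * w n * g (Real.log n) =
      Real.log 2 * w 2 * g (Real.log 2) := by
  have hlog : Real.log 2 + Real.log 2 / 2 < Real.log 3 := by
    have h8 : (3 : ℝ) * Real.log 2 = Real.log 8 := by
      rw [show (8 : ℝ) = 2 ^ 3 by norm_num, Real.log_pow]; norm_num
    have h9 : (2 : ℝ) * Real.log 3 = Real.log 9 := by
      rw [show (9 : ℝ) = 3 ^ 2 by norm_num, Real.log_pow]; norm_num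
    have : Real.log 8 < Real.log 9 := Real.log_lt_log (by norm_num) (by norm_num)
    linarith
  rw [tsum_eq_single 2]
  · rw [ArithmeticFunction.vonMangoldt_apply_prime Nat.prime_two]
    push_cast
    ring
  · intro n hn
    rcases Nat.lt_or_ge n 3 with h3 | h3
    · interval_cases n
      · simp
      · simp [ArithmeticFunction.vonMangoldt_apply_one]
      · exact absurd rfl hn
    · have hgn : g (Real.log n) = 0 := by
        apply image_eq_zero_of_notMem_tsupport
        intro hmem
        have h := (hg hmem).2
        have h3' : Real.log 3 ≤ Real.log n :=
          Real.log_le_log (by norm_num) (by exact_mod_cast h3)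
        linarith
      simp [hgn]

end FiniteCarrierNoOrbitAtoms

/-! ## The technique class: finite-dimensional (graded) flow carriers and their Lefschetz densities -/

/-- A **finite-dimensional flow carrier**: finitely many finite-dimensional complex vector spaces
`H^i = ℂ^{d_i}` (`i < k`, the graded pieces of a would-be dynamical cohomology), each with a weight
`c_i ∈ ℂ` (the sign `(-1)^i` of the alternating sum, or any multiplicity) and a CONTINUOUS
one-parameter family of operators `t ↦ T_i(t) ∈ M_{d_i}(ℂ)` (the induced flow `φ^{t*}` on `H^i`;
for an infinitesimal generator `Θ_i` this is `T_i(t) = exp (t Θ_i)`, see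
`FiniteLefschetzCarrier.ofGenerators`). This is the Lean form of "all reduced leafwise cohomology
groups `H̄^n_𝓕(X)` are finite dimensional" in Deninger's remark and of "`H̄(𝓕)` is of finite
dimension" in Álvarez López–Kordyukov's Corollary 1.4.
[cite: Deninger2002, §3 after Thm 3.3] [cite: AlvarezLopezKordyukov2008, Cor 1.4] -/
structure FiniteLefschetzCarrier where
  /-- number of graded pieces -/
  k : ℕ
  /-- weight of the `i`-th piece in the alternating sum (e.g. `(-1)^i`) -/
  weight : Fin k → ℂ
  /-- dimension of the `i`-th piece -/
  dim : Fin k → ℕ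
  /-- the one-parameter family of operators on the `i`-th piece (e.g. `t ↦ exp (t • Θ i)`) -/
  op : (i : Fin k) → ℝ → Matrix (Fin (dim i)) (Fin (dim i)) ℂ
  /-- the family is continuous in `t` (automatic for `exp (t • Θ)`) -/
  continuous_op : ∀ i, Continuous (op i)

namespace FiniteLefschetzCarrier

variable (C : FiniteLefschetzCarrier)

/-- The **Lefschetz density** `L_C(t) = Σ_i c_i · tr T_i(t)` of a finite carrier — the
"alternating sum of traces" `Σ_n (-1)^n Tr(φ^{t*} | H^n)` read at finite level.
[cite: Deninger2002, §3 after Thm 3.3] -/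
def density (t : ℝ) : ℂ := ∑ i, C.weight i * Matrix.trace (C.op i t)

/-- The **Lefschetz distribution** of a finite carrier on a (real) test function `g`:
`g ↦ ∫ g(t) L_C(t) dt`, i.e. `Σ_i c_i tr ∫ g(t) T_i(t) dt` — the distribution
`Σ_n (-1)^n Tr(φ^* | H̄^n)` of [Deninger2002, §3 (11)–(12)], `φ ↦ tr A_φ` with
`A_φ = ∫ φ(t) φ^{t*} dt`, read for a finite-dimensional carrier. [cite: Deninger2002, Thm 3.3] -/
def distribution (g : ℝ → ℝ) : ℂ := ∫ t, g t • C.density t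

/-- The Lefschetz density of a finite carrier is a continuous function — the finite-dimensional
shadow of "the alternating sum of traces would be a smooth function".
[cite: Deninger2002, §3 after Thm 3.3] -/
theorem continuous_density : Continuous C.density :=
  continuous_finsetSum _ fun i _ => continuous_const.mul (C.continuous_op i).matrix_trace

section Generators

set_option backward.isDefEq.respectTransparency false in
open scoped Matrix.Norms.Operator in
/-- For a square complex matrix `Θ` the one-parameter group `t ↦ exp (t Θ)` is continuous (indeed
differentiable; Mathlib's `differentiable_exp_smul_const` in the Banach algebra
`M_d(ℂ)` with the `ℓ^∞`-operator norm). [folklore] -/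
private theorem continuous_exp_smul {d : ℕ} (Θ : Matrix (Fin d) (Fin d) ℂ) :
    Continuous fun t : ℝ => NormedSpace.exp (t • Θ) :=
  (differentiable_exp_smul_const ℝ Θ).continuous

/-- The finite carrier of a family of INFINITESIMAL GENERATORS `Θ_i ∈ M_{d_i}(ℂ)` with weights
`c_i`: `T_i(t) = exp (t Θ_i)`, so that `L_C(t) = Σ_i c_i tr e^{t Θ_i}` (an exponential polynomial
`Σ_i c_i Σ_λ m_λ e^{λ t}` over the spectra). [cite: Deninger2002, §3 after Thm 3.3] -/
def ofGenerators (k : ℕ) (weight : Fin k → ℂ) (dim : Fin k → ℕ)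
    (Θ : (i : Fin k) → Matrix (Fin (dim i)) (Fin (dim i)) ℂ) : FiniteLefschetzCarrier where
  k := k
  weight := weight
  dim := dim
  op i t := NormedSpace.exp (t • Θ i)
  continuous_op i := continuous_exp_smul (Θ i)

/-- The Lefschetz density of `ofGenerators` is `Σ_i c_i tr e^{t Θ_i}` — the finite-level form of
Deninger's `Tr(φ^* | H^n) := Σ_{λ ∈ Sp^n(Θ)} e^{tλ}` (for finite-dimensional `H^n` the sum over the
spectrum with multiplicities is `tr e^{tΘ}`). [cite: Deninger2002, Thm 5.9] -/
@[simp] theorem density_ofGenerators (k : ℕ) (weight : Fin k → ℂ) (dim : Fin k → ℕ)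
    (Θ : (i : Fin k) → Matrix (Fin (dim i)) (Fin (dim i)) ℂ) (t : ℝ) :
    (ofGenerators k weight dim Θ).density t =
      ∑ i, weight i * Matrix.trace (NormedSpace.exp (t • Θ i)) := rfl

end Generators

/-! ## The obstruction -/

/-- **No atoms in the Lefschetz distribution of a finite carrier.** If on some window
`(a - ε, a + ε)` the Lefschetz distribution of a finite-dimensional flow carrier equals
`m • δ_a + h` with `h` integrable on the window, then `m = 0`.
[cite: Deninger2002, §3 after Thm 3.3] [cite: AlvarezLopezKordyukov2008, Cor 1.4] -/
theorem atomWeight_eq_zero {a ε : ℝ} {m : ℂ} {h : ℝ → ℂ} (hε : 0 < ε)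
    (hh : IntegrableOn h (Ioo (a - ε) (a + ε)))
    (H : ∀ g : ℝ → ℝ, ContDiff ℝ ∞ g → HasCompactSupport g →
      tsupport g ⊆ Ioo (a - ε) (a + ε) → C.distribution g = m * g a + ∫ t, g t • h t) :
    m = 0 :=
  FiniteCarrierNoOrbitAtoms.atomWeight_eq_zero_of_continuous hε C.continuous_density hh H

/-- **Álvarez López–Kordyukov's Corollary 1.4 at finite level**: if the Lefschetz distribution of a
finite-dimensional flow carrier is supported in a closed Lebesgue-null set `D ⊂ ℝ` (for a
dynamical trace formula: the discrete set of periods `k · l(γ)`), then its Lefschetz density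
vanishes identically — "`L_dis(𝓕) ≡ L(𝓕) = 0`: it vanishes just when it can be defined".
[cite: AlvarezLopezKordyukov2008, Cor 1.4] -/
theorem density_eq_zero_of_support_null {D : Set ℝ} (hD : IsClosed D) (hD0 : volume D = 0)
    (H : ∀ g : ℝ → ℝ, ContDiff ℝ ∞ g → HasCompactSupport g → tsupport g ⊆ Dᶜ →
      C.distribution g = 0) :
    C.density = 0 :=
  FiniteCarrierNoOrbitAtoms.eq_zero_of_continuous_of_integral_eq_zero_off_null
    C.continuous_density hD hD0 H

/-- In particular (countable closed period sets are null): a finite carrier whose Lefschetz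
distribution lives on a countable closed set of periods has Lefschetz density `0`.
[cite: AlvarezLopezKordyukov2008, Cor 1.4] -/
theorem density_eq_zero_of_support_countable {D : Set ℝ} (hD : IsClosed D) (hDc : D.Countable)
    (H : ∀ g : ℝ → ℝ, ContDiff ℝ ∞ g → HasCompactSupport g → tsupport g ⊆ Dᶜ →
      C.distribution g = 0) :
    C.density = 0 :=
  C.density_eq_zero_of_support_null hD (hDc.measure_zero volume) H

/-- **Deninger's remark, arithmetic side.** In the dictionary "closed orbit `γ` ↔ prime `p`,
`l(γ) = log p`, `k`-th iterate ↔ `p^k`" the closed-orbit side of the would-be dynamical trace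
formula for `Spec ℤ` is the von Mangoldt distribution `g ↦ Σ_n Λ(n) w(n) g(log n)`
(`w(n) = 1` in the normalisation of [Deninger2002, (12)]; `w(n) = n^{-1/2}` after the twist
`e^{-t/2} φ^{t*}`; any weights with `w(2) ≠ 0`). No finite-dimensional flow carrier reproduces it,
not even on the window around `log 2` and not even modulo an integrable function `h` (archimedean
and `δ_0`-type terms are smooth away from `t = 0`): the atom `log 2 · w(2) · δ_{log 2}` would have
to vanish. [cite: Deninger2002, §3 after Thm 3.3] -/
theorem not_vonMangoldt_side (w : ℕ → ℂ) (hw : w 2 ≠ 0) (h : ℝ → ℂ)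
    (hh : IntegrableOn h (Ioo (Real.log 2 - Real.log 2 / 2) (Real.log 2 + Real.log 2 / 2))) :
    ¬ ∀ g : ℝ → ℝ, ContDiff ℝ ∞ g → HasCompactSupport g →
        tsupport g ⊆ Ioo (Real.log 2 - Real.log 2 / 2) (Real.log 2 + Real.log 2 / 2) →
        C.distribution g =
          (∑' n : ℕ, (ArithmeticFunction.vonMangoldt n : ℂ) * w n * g (Real.log n)) +
            ∫ t, g t • h t := by
  intro H
  have hε : 0 < Real.log 2 / 2 := by positivity
  have hm : ((Real.log 2 : ℂ) * w 2) = 0 := by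
    refine C.atomWeight_eq_zero hε hh fun g hg hc hs => ?_
    rw [H g hg hc hs, FiniteCarrierNoOrbitAtoms.tsum_vonMangoldt_window w hs]
  have h2 : (Real.log 2 : ℂ) ≠ 0 := by exact_mod_cast (Real.log_pos one_lt_two).ne'
  exact mul_ne_zero h2 hw hm

end FiniteLefschetzCarrier

/-! ## The catalogued barrier -/

/-- **Barrier `FiniteCarrierNoOrbitAtoms`** (Deninger 2002, remark after Thm 3.3; Álvarez López–
Kordyukov 2008, Cor 1.4): the Lefschetz distribution `g ↦ ∫ g(t) Σ_i c_i tr T_i(t) dt` of a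
FINITE-DIMENSIONAL flow carrier (finitely many finite-dimensional pieces `H^i`, weights `c_i`,
continuous one-parameter families `T_i(t)`, e.g. `e^{tΘ_i}`) has NO ATOMS: if on a window
`(a - ε, a + ε)` it equals `m · δ_a + h` with `h` integrable, then `m = 0`. Hence a dynamical
Lefschetz trace formula of the shape (11)/(12) of [Deninger2002] — alternating trace of the flow on
cohomology `=` `χ · δ_0 + Σ_γ l(γ) Σ_k ε_γ(k) δ_{k l(γ)}` (for `Spec ℤ`: `Σ_p log p Σ_k δ_{k log p}`
plus smooth terms) — can hold on an open window containing a period only if every graded piece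
being finite-dimensional is given up: "if the right hand side of (12) is non-zero, at least one of
the cohomology groups `H̄^n_𝓕(X)` must be infinite dimensional. Otherwise the alternating sum of
traces would be a smooth function and hence have empty singular support."
PROVED (`FiniteCarrierNoOrbitAtoms_holds`); companions: `FiniteLefschetzCarrier.not_vonMangoldt_side`
(the prime atoms, window around `log 2`), `FiniteLefschetzCarrier.density_eq_zero_of_support_null`
(Cor 1.4 form: support in a null set of periods ⇒ Lefschetz density `≡ 0`).

BARRIER (structured block, D-0021):
- technique_class: finite-dimensional-graded-flow-carrier finite-truncation-of-Deninger-dynamical-cohomology-with-continuous-time-flow exp(tΘ)-on-finite-dimensional-H^n exact-untruncated-dynamical-Lefschetz-trace-formula-as-distribution-on-a-t-window finite-dimensional-reduced-leafwise-cohomology-with-closed-orbits — in Lean: `FiniteLefschetzCarrier` (pieces `ℂ^{d_i}`, weights `c_i`, continuous `T_i : ℝ → M_{d_i}(ℂ)`, e.g. `FiniteLefschetzCarrier.ofGenerators` with `T_i(t) = exp (t Θ_i)`) and its `FiniteLefschetzCarrier.distribution g = ∫ g • Σ_i c_i tr T_i`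
- blocks: every finite-dimensional `(H^•, φ^{t*})` — any finite-level model or truncation of the hoped-for dynamical cohomology of `Spec ℤ` / `Spec 𝔬_K` with its `ℝ`-flow, and any foliated flow all of whose reduced leafwise cohomology groups are finite-dimensional — asserting the dynamical trace formula (11)/(12) of [cite: Deninger2002, Thm 3.3] (resp. its arithmetic analogue with closed-orbit side `Σ_p log p Σ_{k≥1} δ_{k log p}`, i.e. `g ↦ Σ_n Λ(n) w(n) g(log n)`, `not_vonMangoldt_side`) as an identity of distributions on an open `t`-window containing a period `k·l(γ)` (resp. `k log p`) with non-zero total coefficient; in the Lie-foliation setting "If `H̄(𝓕)` is of finite dimension and `codim 𝓕 > 0`, then `L_dis(𝓕) ≡ L(𝓕) = 0`" [cite: AlvarezLopezKordyukov2008, Cor 1.4]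
- because: finite-dimensional pieces make `t ↦ Σ_n (-1)^n Tr(φ^{t*}|H^n) = Σ_i c_i tr T_i(t)` a continuous function (`FiniteLefschetzCarrier.continuous_density`), so the Lefschetz distribution is an `L¹_loc` density; pairing with smooth bumps `g_n` at `a` (`g_n(a) = 1`, supports shrinking to `{a}`) tends to `0` by dominated convergence (`FiniteCarrierNoOrbitAtoms.tendsto_integral_bump_smul`) while `m · g_n(a) = m`, so `m = 0` (`FiniteCarrierNoOrbitAtoms.atomWeight_eq_zero`) — "Otherwise the alternating sum of traces would be a smooth function and hence have empty singular support" [cite: Deninger2002, §3 after Thm 3.3]; a continuous density whose distribution is supported in a Lebesgue-null closed set is `0` a.e. (fundamental lemma of the calculus of variations, Mathlib `IsOpen.ae_eq_zero_of_integral_contDiff_smul_eq_zero`) hence `≡ 0` — "`L_dis(𝓕)` is supported in the union of a discrete set of orbits … it vanishes just when it can be defined" [cite: AlvarezLopezKordyukov2008, Cor 1.4]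
- evasions_known: INFINITE-dimensional carriers with distribution-valued traces: (a) reduced leafwise cohomology `H̄^•_𝓕(X)` of a flow transversal to a codimension-one foliation, `Tr(φ^*|H̄^n)(φ) := tr ∫ φ(t) φ^{t*} dt` (trace class), for which (12) is a THEOREM [cite: Deninger2002, Thm 3.3] (= Álvarez López–Kordyukov); (b) the `q^ℤ`-laminated / solenoidal systems attached to an (ordinary) elliptic curve over `𝔽_p`, where `H^1_{𝓕𝓛}(X)` is infinite-dimensional with `Θ`-spectrum `{(log ξ + 2πiν)/l}` and `Tr := Σ_{λ ∈ Sp(Θ)} e^{tλ}` converges as a distribution to the closed-orbit atoms [cite: Deninger2002, Thm 5.9, Example 1]; (c) for `Spec ℤ` Deninger accordingly postulates `H^1` infinite-dimensional ("an infinite dimensional dissipative dynamical system", [cite: Deninger2002, §5 last paragraph]); no finite-dimensional evasion is published — finite truncations can only be compared with the closed-orbit side through finitely many test functions / moments, never as distributions on a window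
- status: established (elementary; PROVED here unconditionally)
- scope_caveats: the entry formalises exactly the printed step "finite-dimensional ⇒ alternating trace continuous ⇒ no singular support"; it constrains EXACT identities of distributions on an open window containing an atom and says NOTHING about (i) identities tested against a finite or band-limited family of test functions, or equality of finitely many moments/traces `tr T(t_j)` (finite truncations routinely match those), (ii) DISCRETE-time carriers (a Frobenius `F` on a finite-dimensional `H^1(E)` acting at times `ν log q`: there both sides are atomic, `Σ_ν tr(F^ν) δ_{ν log q}`, and the Grothendieck–Lefschetz formula holds at finite level), (iii) infinite-dimensional carriers (the evasions above), (iv) smoothed or regularised trace formulas; Deninger's sentence concerns reduced leafwise cohomology of an actual foliated dynamical system — the Lean statement abstracts the finite-dimensional mechanism and applies verbatim to any continuous one-parameter family of matrices on finite-dimensional pieces (one-parameter groups `e^{tΘ}` being the case `ofGenerators`)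

[cite: Deninger2002, §3 after Thm 3.3] [cite: AlvarezLopezKordyukov2008, Cor 1.4] -/
def FiniteCarrierNoOrbitAtoms : Prop :=
  ∀ (C : FiniteLefschetzCarrier) (a ε : ℝ) (m : ℂ) (h : ℝ → ℂ), 0 < ε →
    IntegrableOn h (Ioo (a - ε) (a + ε)) →
    (∀ g : ℝ → ℝ, ContDiff ℝ ∞ g → HasCompactSupport g → tsupport g ⊆ Ioo (a - ε) (a + ε) →
        C.distribution g = m * g a + ∫ t, g t • h t) →
    m = 0

/-- **The barrier holds unconditionally.**
[cite: Deninger2002, §3 after Thm 3.3] [cite: AlvarezLopezKordyukov2008, Cor 1.4] -/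
theorem FiniteCarrierNoOrbitAtoms_holds : FiniteCarrierNoOrbitAtoms :=
  fun C _a _ε _m _h hε hh H => C.atomWeight_eq_zero hε hh H

/-! ## Consequences in the printed wording -/

/-- Deninger's sentence as a non-existence statement: if the right-hand side of the trace formula
has a non-zero atom `m · δ_a` (modulo an integrable function) on some window, then NO
finite-dimensional carrier satisfies the formula there — "at least one of the cohomology groups
must be infinite dimensional". [cite: Deninger2002, §3 after Thm 3.3] -/
theorem not_exists_finiteLefschetzCarrier_of_atom {a ε : ℝ} {m : ℂ} {h : ℝ → ℂ} (hε : 0 < ε)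
    (hm : m ≠ 0) (hh : IntegrableOn h (Ioo (a - ε) (a + ε))) :
    ¬ ∃ C : FiniteLefschetzCarrier, ∀ g : ℝ → ℝ, ContDiff ℝ ∞ g → HasCompactSupport g →
        tsupport g ⊆ Ioo (a - ε) (a + ε) → C.distribution g = m * g a + ∫ t, g t • h t :=
  fun ⟨C, H⟩ => hm (FiniteCarrierNoOrbitAtoms_holds C a ε m h hε hh H)

/-- The closed-orbit term of ONE non-degenerate closed orbit `γ` (length `l > 0`, sign
`ε_γ(1) = ±1`, no other period in the window) is not the Lefschetz distribution of a finite
carrier: `m = l · (±1) ≠ 0`. [cite: Deninger2002, §3 after Thm 3.3] -/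
theorem not_exists_finiteLefschetzCarrier_closedOrbit {l ε : ℝ} (hl : 0 < l) (hε : 0 < ε)
    (sgn : ℤˣ) {h : ℝ → ℂ} (hh : IntegrableOn h (Ioo (l - ε) (l + ε))) :
    ¬ ∃ C : FiniteLefschetzCarrier, ∀ g : ℝ → ℝ, ContDiff ℝ ∞ g → HasCompactSupport g →
        tsupport g ⊆ Ioo (l - ε) (l + ε) →
        C.distribution g = (l * (sgn : ℤ) : ℂ) * g l + ∫ t, g t • h t :=
  not_exists_finiteLefschetzCarrier_of_atom hε
    (mul_ne_zero (by exact_mod_cast hl.ne') (by exact_mod_cast (Units.ne_zero sgn))) hh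

end Literature.Barriers.RiemannHypothesis
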